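import Summits.ResolutionOfSingularities.ResolutionOfSingularities.Theorems.WeightedInvariantRatContactDescent
import Summits.ResolutionOfSingularities.ResolutionOfSingularities.Theorems.WeightedInvariantIota3SigmaAscent
import Summits.ResolutionOfSingularities.ResolutionOfSingularities.Theorems.WeightedInvariantIota3FlagTools
import HarnessLib

/-!
# THE RATIO LETTER σ₁ IS COMPATIBLE WITH ESSENTIALLY SMOOTH LOCAL MAPS OF EQUAL DIMENSION THREE — the provable half of (c11σ)
# (door `HypersurfaceCentreConstruction`, stmt-ResolutionOfSingularities-19897; P3 rung clause (c11)≤3 for σ; (o53-desc′) PART 1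
# corollary; hand res-L1-w43-stub-3)

Topic: `Summits/ResolutionOfSingularities/ResolutionOfSingularities/Theorems`. Helper for the door item
`HypersurfaceCentreConstruction` (stmt-ResolutionOfSingularities-19897, route `WeightedInvariant`), line `local-engine` (L W4.3),
def-free.

**What is proved.** `φ : S → S'` local, formally smooth, essentially of finite type between regular local rings of dimension
three with `𝔪_S S' = 𝔪_{S'}`, `f ∈ 𝔪_S ∖ 0`.  Then the RATIO WITNESS SETS of res-type-073/057's `Iota3.sigmaRatioNat`
(`{m | ∃ admissible (q;r₁,r₂) reached by a two-flag, m·r₂ ≤ ν!·r₁}`) coincide for `f` and `φ f` (`sigmaRatio_witness_eq`), hence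
**`sigmaRatioNat (φ f) = sigmaRatioNat f`** and **`iotaSigmaRatio S' (φ f) = iotaSigmaRatio S f`** — with NO boundedness
hypothesis (equal sets have equal `sSup`, junk included).  Ascent `⊆` is res-type-057's `sigmaRatio_witness_algebraMap` (p530558);
descent is: a two-flag reach upstairs ⇒ a ONE-flag reach of the weight `r₁/r₂` upstairs (res-L1-w43-idea-2's collapse
`FlagReaches.oneFlagReaches`, p560066) ⇒ the same one-flag reach DOWNSTAIRS (`JFlatEssSmooth.oneFlagReaches_of_algebraMap`, this
hand's PART 1) ⇒ a two-flag reach of `(r₂; r₁, r₂)` downstairs with any r.s.p. partner (`flagReaches_of_mem_ratContactFiltration`,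
`isTwoFlag_of_rsp`).

**What is NOT claimed.** The LEVEL letter `σ₂` / `iotaSigma` itself: two-flag reach does NOT descend in general (memo O53-DESC-CEX:
`f = w³ + Q(u,v)²`), so the level set needs σ-MAXIMISER descent ((o70-b) + a rationality argument) — open.

[OURS · L1 W4.3 · (c11σ) ratio half]  Replaces the role of NO printed item; NOT a statement of the manuscript
[claim: Hironaka2017, status: under-review]. AI work, weaker than expert review.  Named facts: through p548127 only ((F2)–(F4)).

## References

* H. Hironaka, *Characteristic polyhedra of singularities*, J. Math. Kyoto Univ. 7 (1967), §3, Thm. (4.8). [Hironaka1967]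
* A. Grothendieck, *EGA IV*, Publ. Math. IHÉS 20 (1964), 0_IV (19.6.1), (19.7.1), (17.5.1). [EGA0IV]
-/

noncomputable section

open IsLocalRing Literature.AlgebraicGeometry.Resolution
open Summit.ResolutionOfSingularities.ResolutionOfSingularities.Cruxes.HypersurfaceCentreConstruction.LocalEngine
open Summit.ResolutionOfSingularities.ResolutionOfSingularities.Cruxes.HypersurfaceCentreConstruction.LocalEngine.Iota3
open Summit.ResolutionOfSingularities.ResolutionOfSingularities.Cruxes.HypersurfaceCentreConstruction.LocalEngine.Iota3.RatContact

set_option linter.dupNamespace false -- mandated namespace of this single-conjunct summit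

namespace Summit.ResolutionOfSingularities.ResolutionOfSingularities.Theorems

namespace JFlatEssSmooth

variable {S S' : Type} [CommRing S] [CommRing S'] [IsRegularLocalRing S] [IsRegularLocalRing S'] [Algebra S S']
  [IsLocalHom (algebraMap S S')] [Algebra.FormallySmooth S S'] [Algebra.EssFiniteType S S']

/-- **A one-flag reach gives a two-flag reach of `(b; a, b)`** in a regular local ring of dimension three (complete the
parameter to a regular system; two members of it form a two-flag). [cite: Hironaka1967, §3] -/
theorem flagReaches_of_oneFlagReaches (hdim : ringKrullDim S = (3 : ℕ)) {f : S} {ν a b : ℕ} (h : OneFlagReaches f ν a b) :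
    FlagReaches f ν b a b := by
  obtain ⟨g, hg, hg2, hmem⟩ := h
  have hd3 : (maximalIdeal S).spanFinrank = 3 := spanFinrank_eq_three_of_ringKrullDim (by rw [hdim, Nat.cast_ofNat])
  obtain ⟨z, hz, hz0⟩ := exists_rsop_apply_eq hd3 hg hg2 (0 : Fin 3)
  have hfl : IsTwoFlag (z 0) (z 1) := isTwoFlag_of_rsp hd3 z hz (i := 0) (j := 1) (by decide)
  rw [hz0] at hfl
  exact flagReaches_of_mem_ratContactFiltration hfl hmem

/-- **The ratio witness sets coincide along `φ`.** [cite: Hironaka1967, §3, Thm. (4.8)] [cite: EGA0IV, 0_IV (19.7.1)]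
[OURS · L1 W4.3 · (c11σ) ratio half] -/
theorem sigmaRatio_witness_eq (h𝔪 : (maximalIdeal S).map (algebraMap S S') = maximalIdeal S')
    (hdim : ringKrullDim S = (3 : ℕ)) (hdim' : ringKrullDim S' = (3 : ℕ)) {f : S} (hf0 : f ≠ 0) (hf : f ∈ maximalIdeal S) :
    {m : ℕ | ∃ q r₁ r₂ : ℕ, AdmissibleTriple q r₁ r₂ ∧
        FlagReaches (algebraMap S S' f) (adicOrder (algebraMap S S' f)).toNat q r₁ r₂ ∧
        m * r₂ ≤ ratioScale (adicOrder (algebraMap S S' f)).toNat * r₁} =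
      {m : ℕ | ∃ q r₁ r₂ : ℕ, AdmissibleTriple q r₁ r₂ ∧ FlagReaches f (adicOrder f).toNat q r₁ r₂ ∧
        m * r₂ ≤ ratioScale (adicOrder f).toNat * r₁} := by
  haveI : Module.Flat S S' := IotaOrderEssSmooth.flat_of_formallySmooth_of_essFiniteType S S'
  refine le_antisymm ?_ (sigmaRatio_witness_algebraMap h𝔪 f)
  rintro m ⟨q, r₁, r₂, hadm, hreach, hle⟩
  rw [adicOrder_algebraMap_eq_of_flat h𝔪] at hreach hle
  have hr₂ : 0 < r₂ := lt_of_lt_of_le hadm.1 hadm.2.1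
  have h1 : OneFlagReaches (algebraMap S S' f) (adicOrder f).toNat r₁ r₂ := FlagReaches.oneFlagReaches hadm hreach
  have h2 : OneFlagReaches f (adicOrder f).toNat r₁ r₂ := oneFlagReaches_of_algebraMap h𝔪 hdim hdim' hf0 hf hr₂ r₁ h1
  exact ⟨r₂, r₁, r₂, ⟨hr₂, le_rfl, hadm.2.2⟩, flagReaches_of_oneFlagReaches hdim h2, hle⟩

/-- **THE RATIO LETTER IS COMPATIBLE WITH `φ`**: `sigmaRatioNat (φ f) = sigmaRatioNat f`. [cite: Hironaka1967, §3, Thm. (4.8)]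
[OURS · L1 W4.3 · (c11σ) ratio half] -/
theorem sigmaRatioNat_algebraMap_eq (h𝔪 : (maximalIdeal S).map (algebraMap S S') = maximalIdeal S')
    (hdim : ringKrullDim S = (3 : ℕ)) (hdim' : ringKrullDim S' = (3 : ℕ)) {f : S} (hf0 : f ≠ 0) (hf : f ∈ maximalIdeal S) :
    sigmaRatioNat (algebraMap S S' f) = sigmaRatioNat f := by
  unfold sigmaRatioNat
  rw [sigmaRatio_witness_eq h𝔪 hdim hdim' hf0 hf]

/-- **THE ORDINAL RATIO LETTER IS COMPATIBLE WITH `φ`**: `iotaSigmaRatio S' (φ f) = iotaSigmaRatio S f`.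
[cite: Hironaka1967, §3, Thm. (4.8)] [OURS · L1 W4.3 · (c11σ) ratio half] -/
theorem iotaSigmaRatio_algebraMap_eq (h𝔪 : (maximalIdeal S).map (algebraMap S S') = maximalIdeal S')
    (hdim : ringKrullDim S = (3 : ℕ)) (hdim' : ringKrullDim S' = (3 : ℕ)) {f : S} (hf0 : f ≠ 0) (hf : f ∈ maximalIdeal S) :
    iotaSigmaRatio S' (algebraMap S S' f) = iotaSigmaRatio S f := by
  unfold iotaSigmaRatio
  rw [dif_pos (inferInstance : IsLocalRing S'), dif_pos (inferInstance : IsLocalRing S),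
    sigmaRatioNat_algebraMap_eq h𝔪 hdim hdim' hf0 hf]

end JFlatEssSmooth

end Summit.ResolutionOfSingularities.ResolutionOfSingularities.Theorems

end
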